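import Literature.AnabelianGeometry.EtaleTheta.Discharge.Sec2ModelConstantMultiple
import Literature.AnabelianGeometry.EtaleTheta.Discharge.Sec2ModelCor219Origin
import Literature.AnabelianGeometry.EtaleTheta.Discharge.Sec2DtpYThetaAbelian
import Literature.AnabelianGeometry.EtaleTheta.Discharge.Sec2Cor218ivOfSetting
import HarnessLib

/-!
# [EtTh] Cor. 2.19 (ii) (discrete rigidity) for the §1 MODEL tower, modulo FACT-policy inputs —
# capstone of the lane-C2 §2 discharge

Mochizuki, *The Étale Theta Function …* [EtTh], Publ. RIMS 45 (2009), §2, Cor. 2.19 (ii) pp.64–66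
(locators `p.N` = PDF pages of the PRIMS text; bib key `MochizukiEtTh2009`). PROOF-ONLY (no `def`, no
new named fact; seat abc-iut-L2-d1, DAG node `EtTh:Cor2.19(ii)`, LONG-CHAINS lane C2).

`DoubleUnderline.cor219_ii_model_of_facts`: the named fact `ThetaEnvTower.Cor219_ii` HOLDS for
abc-iut-L2-t8's model tower `thetaEnvTower C τ hC hS` of the §1 theta setting, with EVERY hypothesis
either printed DATA (`D`, `E`, `C` = the choice of `X̲̲`, `τ` = compatible cyclotomes, `L` = cusp
labels), a §1/§2 hypothesis structure (`Compat`, `Sec2Hyps`), a NAMED FACT of [EtTh] §1 typed by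
abc-iut-L2-t1 (`Prop15ii`, `Prop15iii` = Prop. 1.5 (ii), (iii)), an INTERFACE FACT of the tempered
fundamental group (`IsSlimGroup Π^tp_X` = [SemiAnbd] Ex. 3.10 temp-slimness; `IsOpenMap aug` =
topological exactness of `1 → Δ^tp_X → Π^tp_X → G_K → 1`, [SemiAnbd] p.69), a FACT-POLICY anabelian
input (Cor. 2.18 (i) `RigidData.Cor218_i`; the constant multiple rigidity of the theta collection as
abc-iut-L2-t2's NAMED FACT `ThetaEnvTower.Cor219_iii` = Cor. 2.19 (iii), tower form — turned into
abc-iut-L2-t10's cocycle-level `hcoll` by `Sec2ModelConstantMultiple.lean`), or the §1 ORIGIN hypotheses through which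
abc-iut-L5-t14's `rigidData_prop214_i` proves Prop. 2.14 (i) for the model (`IsEtThOrigin`; "`(Δ^tp_Y)^Θ`
abelian" being abc-iut-L2-t8's theorem `dtpYTheta_comm`; "… profinite" `hYcl`; `G_K` centre-free
being a theorem). Assembled from: abc-iut-L2-d1 gen 0
(`cor219_ii_of`, Cor. 2.18 (iii) inputs from temp-slimness, `Cor218_iv_reduction` from Kummer
lifting), gen 2 (`Sec2ModelKummerLifting`: Kummer lifting PROVED via Hilbert 90), abc-iut-L2-t10
(`cor218_iv_fibre_of_prop214_i`; `rigidData_cor218_iv_surjective` ⟸ Cor. 2.18 (i), (ii) + `hcoll`,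
with Cor. 2.18 (ii) for the model ⟸ Prop. 1.5 (ii), (iii)). HONEST FRAMING: conditional discharge
modulo the inputs listed; no side is taken on [IUTchIII] Cor. 3.12; typed ≠ discharged elsewhere.
-/

noncomputable section

namespace Literature.AnabelianGeometry.EtaleTheta

open Literature.AnabelianGeometry.SemiGraphs
open Literature.AlgebraicGeometry.Frobenioids (IsSlimGroup)

namespace ThetaSetting.EtaleThetaData.DoubleUnderline

variable {p : ℕ} [Fact p.Prime] {D : ThetaSetting p} {E : D.EtaleThetaData} {l : ℕ}
  (C : E.DoubleUnderline l) {Es : Set ℕ+} (τ : D.CyclotomeTower l Es)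

/-- **Cor. 2.19 (ii) (discrete rigidity) for the §1 MODEL tower, modulo FACT-policy inputs only**:
"any projective system of mono-theta environments is isomorphic to the natural one" (p.64) HOLDS for
`thetaEnvTower C τ hC hS`, given: Prop. 1.5 (ii), (iii) (`h15ii`, `h15`); temp-slimness of `Π^tp_X`
(`hslimX`); openness of `Π^tp_X → G_K` (`haugOpen`); at every level `M ∈ E`, Cor. 2.18 (i) for the
instantiated rigidity data (`h218i`, FACT-policy); constant multiple rigidity of the theta collection
as the NAMED FACT `ThetaEnvTower.Cor219_iii` (`h219iii`, Cor. 2.19 (iii) tower form; [EtTh] Thm. 1.6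
behind it); and the §1 origin hypotheses `IsEtThOrigin` (p.12 "`Δ_X` profinite free on 2 generators"),
`hYcl` (p.12 "`(Δ^tp_Y)^Θ` … profinite", `Π_X`-side form), through which abc-iut-L5-t14's
`rigidData_prop214_i` supplies Prop. 2.14 (i) ("… abelian", `hYab`, being abc-iut-L2-t8's THEOREM
`dtpYTheta_comm`). [cite: MochizukiEtTh2009, Cor 2.19 (ii) p.64] -/
theorem cor219_ii_model_of_facts (hC : D.Compat) (hS : D.Sec2Hyps) (h15 : Prop15iii E hC)
    (h15ii : Prop15ii E.toKummerData hC) (L : C.CuspLabels) (hslimX : IsSlimGroup D.PiTemp)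
    (haugOpen : IsOpenMap D.aug)
    (h218i : ∀ M : Es, (C.rigidData (τ.mod M) hC hS h15 L).Cor218_i)
    (h219iii : (C.thetaEnvTower τ hC hS).Cor219_iii)
    (hO : D.IsEtThOrigin)
    (hYcl : (D.DtpY.map D.toHat.toMonoidHom).topologicalClosure ≤
      D.DtpY.map D.toHat.toMonoidHom ⊔ (⁅⁅D.DeltaHat, D.DeltaHat⁆, D.DeltaHat⁆).topologicalClosure) :
    (C.thetaEnvTower τ hC hS).Cor219_ii :=
  C.cor219_ii_model_of_origin τ hC hS h15 L hslimX haugOpen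
    (fun M => C.rigidData_cor218_iv_surjective τ M hC hS h15 h15ii L _ rfl (h218i M)
      (C.hcoll_of_cor219_iii τ hC hS h15 L h218i h219iii M))
    hO (D.dtpYTheta_comm hO) hYcl

end ThetaSetting.EtaleThetaData.DoubleUnderline

end Literature.AnabelianGeometry.EtaleTheta

end
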